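import Summits.HodgeConjecture.HodgeConjecture.Theorems.SixfoldTableXCensusWeilCentralKGeneral
import Summits.HodgeConjecture.HodgeConjecture.Theorems.SixfoldTableXCensusProductRowsUnitary
import HarnessLib

/-!
# TABLE X (dimension 6) — row 20 `E_K² × Y₄(3,1)` (and every `A ∼ Y × C₁ × C₂` with `Y` simple non-CM, not a quartic-field
# fourfold, `C₁, C₂` simple of dimension `< 4`): the DOMAIN membership `dim A = 6 ∧ ¬ 𝒞 A` discharged, and the general-member
# census of L18 with it (cell `pub-hodgeav-hg6`, req-37 (A) Q2b; eng-4 g6, L18b; lead g2 2026-08-29T00:55:39Z)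

HONEST FRAMING. HC, `HC_AV`, `HC_CM`, H2 NOT proved; X2 / X1 stay `@[conjecture]`; the group hypothesis «`Hg(A) ⊇ S(A)(ℂ) ∩ SU_K`»
(general member) and the polarization data stay DISPLAYED. KERNEL ONLY; no definition, no `sorry`, no named fact.

WHY. L18 (`SixfoldTableXCensusWeilCentralKGeneral`, census for all Weil carriers with `K` central) displays `¬ 𝒞 A`. For row 20
`A ∼ Y₄ × E_K × E_K` (`Y₄` simple of type IV(1,0) with `End⁰ = K`, signature `(3,1)`) the residue class is avoided for the same
reason as in L9c (`ProductRows.not_residueClass_of_isIsogenous_prod_of_isSimple_of_not_isOfCMType`, there with ONE simple small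
factor): CM type would pass to the non-CM factor `Y`; a simple quartic-field type-IV fourfold `Y′` with `A ∼ Y′ × Z` is a simple
isogeny factor of `Y × C₁ × C₂` (Milne 1986 §12 / Poincaré reducibility, tree `isSimpleIsogenyFactor_prod_iff`), hence isogenous
to `Y` (but `dim_ℚ End⁰(Y) = 2 ≠ 4`) or to `C₁` or `C₂` (but `dim Cᵢ < 4`). (Row 27 `E_K² × Y₄/M`, `M` biquadratic, IS in `𝒞`
— `Y₄/M` is a quartic-field type-IV fourfold and `E_K²` a CM surface — lead g2 00:55:39Z; it is not a census row.)
* `WeilERows.not_residueClass_of_isIsogenous_prod_prod` — the domain lemma with two small simple factors;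
* **`WeilERows.census_weilType_detOne_general_prod_prod`** (+ `_of_isIsogenous`) — ROW 20, GENERAL MEMBER: `(dim A = 6 ∧ ¬ 𝒞 A) ∧`
  X2-at-`A` `∧` X1-at-`A` under the displayed group hypothesis (L18 `census_weilType_detOne_general`).
[cite: Milne1986AbelianVarieties, §12 p. 122] [cite: MoonenZarhin1999LowDim, Thm. 0.2 and §5 (5.11)]
-/

set_option linter.dupNamespace false

noncomputable section

open CategoryTheory
open Literature.AlgebraicGeometry Literature.AlgebraicGeometry.Motives
open Literature.AlgebraicGeometry.Motives.AbelianVariety (IsIsogenous IsSimple)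
open Literature.AlgebraicGeometry.HodgeTheory
open Literature.AlgebraicGeometry.Milne1999
open Literature.AlgebraicGeometry.VanGeemen1994 (pullbackOne hodgeGroupOne detOnEigenspace)
open Literature.AlgebraicTopology.SingularHomology
open Literature.Barriers.HodgeConjecture
open Summit.HodgeConjecture.HodgeConjecture.Ring2.ClassTargets
open Summit.HodgeConjecture.HodgeConjecture.Ring2.Motiv (ProdCMCell)
open Summit.HodgeConjecture.HodgeConjecture.Ring2.Atlas (IsQuarticFieldTypeIVFourfold)

namespace Summit.HodgeConjecture.HodgeConjecture.TableX.WeilERows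

/-! ## §1 The domain lemma with two small simple factors -/

/-- **`A ∼ Y × (C₁ × C₂)` is OFF the residue class `𝒞 = CM ∪ K3P`** when `Y` is SIMPLE, NOT of CM type, of positive dimension
with `dim Y ≠ 4 ∨ dim_ℚ End⁰(Y) ≠ 4`, and `C₁`, `C₂` are SIMPLE of positive dimension `< 4` (row 20: `Y = Y₄(3,1)`, `C₁ = C₂ = E_K`).
CM type would pass to `Y`; a simple quartic-field fourfold factor would be isogenous to `Y`, `C₁` or `C₂`.
[cite: Milne1986AbelianVarieties, §12 p. 122] [cite: MumfordAV1970, §19 Cor. 1–2 (pp. 173–174)] -/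
theorem not_residueClass_of_isIsogenous_prod_prod {A Y C₁ C₂ : AbelianVariety ℂ} (hYs : Y.IsSimple) (hYcm : ¬ IsOfCMType Y)
    (h0Y : 0 < Y.dim) (hY : Y.dim ≠ 4 ∨ Module.finrank ℚ Y.endAlgebra ≠ 4) (hC₁s : C₁.IsSimple) (h0C₁ : 0 < C₁.dim)
    (hC₁4 : C₁.dim < 4) (hC₂s : C₂.IsSimple) (h0C₂ : 0 < C₂.dim) (hC₂4 : C₂.dim < 4)
    (hA : IsIsogenous A (Y.prod (C₁.prod C₂))) :
    ¬ (IsOfCMType A ∨ ProdCMCell IsQuarticFieldTypeIVFourfold (fun Z ↦ Z.dim = 2) A) := by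
  refine fun h ↦ h.elim (ProductRows.not_isOfCMType_of_isIsogenous_prod_of_left hYcm hA) ?_
  rintro ⟨Y', Z, hYZ, hY', -, -⟩
  obtain ⟨hY'4, hY's, -, hY'rk, -⟩ := hY'
  have hfacA : IsSimpleIsogenyFactor Y' A :=
    (isSimpleIsogenyFactor_congr_right hYZ).mpr ((isSimpleIsogenyFactor_self hY's (by omega)).prod_left)
  have hfac : IsSimpleIsogenyFactor Y' (Y.prod (C₁.prod C₂)) := (isSimpleIsogenyFactor_congr_right hA).mp hfacA
  rcases isSimpleIsogenyFactor_prod_iff.mp hfac with h | h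
  · have hiso : IsIsogenous Y' Y := (isSimpleIsogenyFactor_iff_isIsogenous_of_isSimple hYs h0Y).mp h
    rcases hY with hY | hY
    · exact hY (hiso.dim_eq ▸ hY'4)
    · exact hY (hiso.finrank_endAlgebra_eq ▸ hY'rk)
  · rcases isSimpleIsogenyFactor_prod_iff.mp h with h₁ | h₂
    · have hdim := ((isSimpleIsogenyFactor_iff_isIsogenous_of_isSimple hC₁s h0C₁).mp h₁).dim_eq
      omega
    · have hdim := ((isSimpleIsogenyFactor_iff_isIsogenous_of_isSimple hC₂s h0C₂).mp h₂).dim_eq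
      omega

/-! ## §2 Row 20, general member: the census with domain membership discharged -/

variable (A : AbelianVariety ℂ) (φ : A ⟶ A) (d : ℕ) {h : complexBetti A.X 2}

/-- **TABLE X ROW 20 `E_K² × Y₄(3,1)` (and every `A ∼ Y × C₁ × C₂` as in §1), GENERAL MEMBER, KERNEL VERDICT WITH DOMAIN
MEMBERSHIP**: `(A, φ)` of Weil type `(3, d)` for the diagonal `K`, `h ∈ B¹(A) ⊗ ℂ` with `Q_h` non-degenerate, `φ^*` central and a
`d`-similitude of `Q_h`, and the DISPLAYED «`Hg(A) ⊇ S(A)(ℂ) ∩ SU_K`» ⟹ `(dim A = 6 ∧ ¬ 𝒞 A) ∧` X2-at-`A` `∧` X1-at-`A`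
(L18 `census_weilType_detOne_general` + §1). J1 ×2 for row 20: `exc = (0,0,2,0,0)`. General member only; HC / HC_AV NOT proved.
[cite: MoonenZarhin1999LowDim, Thm. 0.2 and §5 (5.11)] [cite: Milne1999LefschetzClasses, Thm. 3.2 and Cor. 4.5] -/
theorem census_weilType_detOne_general_prod_prod {Y C₁ C₂ : AbelianVariety ℂ} (hYs : Y.IsSimple) (hYcm : ¬ IsOfCMType Y)
    (h0Y : 0 < Y.dim) (hY : Y.dim ≠ 4 ∨ Module.finrank ℚ Y.endAlgebra ≠ 4) (hC₁s : C₁.IsSimple) (h0C₁ : 0 < C₁.dim)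
    (hC₁4 : C₁.dim < 4) (hC₂s : C₂.IsSimple) (h0C₂ : 0 < C₂.dim) (hC₂4 : C₂.dim < 4)
    (hAY : IsIsogenous A (Y.prod (C₁.prod C₂))) (hW : IsWeilType A φ 3 d)
    (hh : h ∈ VanGeemen1994.hodgeClassSpan A.dim A.X 1)
    (hnd : ∀ x : complexBetti A.X 1, (∀ y, polarizationPairingOne A.X h (A.dim - 1) x y = 0) → x = 0)
    (hφC : pullbackOne A φ ∈ centralizerAlgebra A)
    (hφQ : ∀ x y, polarizationPairingOne A.X h (A.dim - 1) (pullbackOne A φ x) (pullbackOne A φ y) =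
      (d : ℂ) • polarizationPairingOne A.X h (A.dim - 1) x y)
    (hG : ∀ (u : complexBetti A.X 1 ≃ₗ[ℂ] complexBetti A.X 1) (hu : u ∈ unitaryCentralizerGroup A h),
      detOnEigenspace u (pullbackOne A φ) (fun x ↦ (mem_centralizerGroup_iff.1 hu.1) φ x)
        (Complex.I * (Real.sqrt d : ℂ)) = 1 → u ∈ hodgeGroupOne A.dim A.X) :
    (A.dim = 6 ∧ ¬ (IsOfCMType A ∨ ProdCMCell IsQuarticFieldTypeIVFourfold (fun Z ↦ Z.dim = 2) A)) ∧
    (∀ c : complexBetti A.X (2 * 2), IsRationalClass c → IsOfHodgeType A.dim A.X (2 * 2) 2 2 c →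
      c ∈ divisorClassesSpan A.X A.dim 2 ⊔ Submodule.span ℂ {w' : complexBetti A.X (2 * 2) |
        ∃ (C : AbelianVariety ℂ) (g : A.X ⟶ C.X) (w : complexBetti C.X (2 * 2)), C.dim < A.dim ∧
          IsRationalClass w ∧ IsOfHodgeType C.dim C.X (2 * 2) 2 2 w ∧ w' = complexBetti.map g (2 * 2) w}) ∧
    (∀ c : complexBetti A.X (2 * 3), IsRationalClass c → IsOfHodgeType A.dim A.X (2 * 3) 3 3 c →
      c ∈ divisorClassesSpan A.X A.dim 3 ⊔ Submodule.span ℂ {w' : complexBetti A.X (2 * 3) |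
          ∃ (a : complexBetti A.X (2 * 2)) (b : complexBetti A.X (2 * 1)),
            IsRationalClass a ∧ IsOfHodgeType A.dim A.X (2 * 2) 2 2 a ∧ IsRationalClass b ∧
            IsOfHodgeType A.dim A.X (2 * 1) 1 1 b ∧ w' = cupProduct (two_mul_add_two_mul 2 1) a b} ⊔
        Submodule.span ℂ {w' : complexBetti A.X (2 * 3) |
          ∃ (C : AbelianVariety ℂ) (g : A.X ⟶ C.X) (w : complexBetti C.X (2 * 3)), C.dim < A.dim ∧
            IsRationalClass w ∧ IsOfHodgeType C.dim C.X (2 * 3) 3 3 w ∧ w' = complexBetti.map g (2 * 3) w} ⊔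
        Submodule.span ℂ {w' : complexBetti A.X (2 * 3) |
          ∃ (B' : AbelianVariety ℂ) (g : A.X ⟶ B'.X) (d : ℕ) (ψ : B' ⟶ B') (w : complexBetti B'.X (2 * 3)),
            B'.dim = 6 ∧ 0 < d ∧ ψ ≫ ψ = -(d • 𝟙 B') ∧ IsRationalClass w ∧
            IsOfHodgeType B'.dim B'.X (2 * 3) 3 3 w ∧ w ∈ weilClassesOf B' ψ 3 d ∧
            w' = complexBetti.map g (2 * 3) w}) :=
  census_weilType_detOne_general A φ d hW
    (not_residueClass_of_isIsogenous_prod_prod hYs hYcm h0Y hY hC₁s h0C₁ hC₁4 hC₂s h0C₂ hC₂4 hAY) hh hnd hφC hφQ hG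

end Summit.HodgeConjecture.HodgeConjecture.TableX.WeilERows
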